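/-
Copyright: H21 programme, solo seat `solo-RiemannHypothesis-informed` (session 5).
-/
import Summits.RiemannHypothesis.RiemannHypothesis.Theorems.SoloInformedClusterFarDecay

/-!
# The near-cluster wall, closed form (solo-informed, T35)

The user-facing form of T25–T34 with every auxiliary parameter (`c`, `R`, `Δ₀`, `θ`) chosen
internally.  For `ψ ≥ 0` smooth on `[−1, 1]` with `Φ(η) > 0`, `0 < η < ½`, a cluster shape
`(N, R₀, δ)` and a decay order `p`, put

  `a(γ₀) = clusterFarC0p ψ N R₀ p δ η + 1 + log log(|γ₀| + 2)/(2η)`   (the double-log window).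

**T35** (`weilGroundEnergy_neg_of_nearCluster_closed_eff`): if `|γ₀| ≥ 1`, `ζ(½ + η + iγ₀) = 0`,
and every off-line zero `ρ` of `ζ` with `|Im ρ − γ₀| < e^{a/(2p+2)}` is `½ ± η + iγ₀` or a member of
a finite set `S'` with `|S'| ≤ N`, `‖ρ − (½ + iγ₀)‖ ≤ R₀` and distance `≥ δ` from `½ ± η + iγ₀`,
then `weilGroundEnergy a < 0`.  Nothing is assumed outside the near zone
`e^{a/(2p+2)} ≍ C (log|γ₀|)^{1/(4η(p+1))}` — an arbitrarily small power of `log|γ₀|` for `p` large —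
and **T35″** is the contrapositive exclusion statement.  (Choices: `c = a − 1`, `R = e^{a/2}`,
`θ = windowMaxOffset γ₀ R < ½`, `Δ₀ = e^{a/(2p+2)}`, so that `e^{θ a} ≤ e^{a/2} = Δ₀^{p+1}`.)
-/

open MeasureTheory Complex Set Filter Topology Literature.NumberTheory.LFunctions
open scoped ContDiff

namespace Summit.RiemannHypothesis.RiemannHypothesis.Theorems

variable {ψ : ℝ → ℝ}

/-- `0 ≤ clusterFarC0p ψ N R₀ p δ η` for `η > 0`, `Φ(η) > 0`, `ψ ≥ 0`. -/
theorem clusterFarC0p_nonneg (hψ0 : ∀ s, 0 ≤ ψ s) {η : ℝ} (hη : 0 < η)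
    (hΦ : 0 < bumpLaplace ψ η) (N : ℕ) (R₀ : ℝ) (p : ℕ) (δ : ℝ) :
    0 ≤ clusterFarC0p ψ N R₀ p δ η := by
  unfold clusterFarC0p
  refine le_max_of_le_left (div_nonneg (Real.log_nonneg ?_) hη.le)
  have := bumpLaplace_nonneg hψ0 (-η)
  have : 0 ≤ 2 * bumpLaplace ψ (-η) / bumpLaplace ψ η := by positivity
  linarith

/-- **T35 (the near-cluster wall, closed form).**  See the module docstring. -/
theorem weilGroundEnergy_neg_of_nearCluster_closed_eff (hψ : ContDiff ℝ ∞ ψ)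
    (hsupp : tsupport ψ ⊆ Icc (-1) 1) (hψ0 : ∀ s, 0 ≤ ψ s) {η : ℝ} (hη : 0 < η)
    (hη2 : η < 1 / 2) (hΦ : 0 < bumpLaplace ψ η) (N : ℕ) (R₀ : ℝ) (p : ℕ) {δ : ℝ} (hδ : 0 < δ)
    (hδ1 : δ ≤ 1) :
    ∀ (γ₀ : ℝ) (S' : Finset ℂ), 1 ≤ |γ₀| → riemannZeta (1 / 2 + η + γ₀ * I) = 0 → S'.card ≤ N →
      (∀ ρ ∈ S', ‖ρ - (1 / 2 + γ₀ * I)‖ ≤ R₀ ∧ δ ≤ ‖ρ - (1 / 2 + η + γ₀ * I)‖ ∧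
          δ ≤ ‖ρ - (1 / 2 - η + γ₀ * I)‖) →
      (∀ ρ : ℂ, riemannZeta ρ = 0 → 0 ≤ ρ.re → ρ.re ≤ 1 →
          |ρ.im - γ₀| < Real.exp ((clusterFarC0p ψ N R₀ p δ η + 1 +
            Real.log (Real.log (|γ₀| + 2)) / (2 * η)) / (2 * p + 2)) → ρ.re ≠ 1 / 2 →
          ρ = 1 / 2 + η + γ₀ * I ∨ ρ = 1 / 2 - η + γ₀ * I ∨ ρ ∈ S') →
      weilGroundEnergy (clusterFarC0p ψ N R₀ p δ η + 1 +
        Real.log (Real.log (|γ₀| + 2)) / (2 * η)) < 0 := by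
  intro γ₀ S' hγ hζ hcard hclus hnear
  set c : ℝ := clusterFarC0p ψ N R₀ p δ η + Real.log (Real.log (|γ₀| + 2)) / (2 * η) with hc_def
  have ea : clusterFarC0p ψ N R₀ p δ η + 1 + Real.log (Real.log (|γ₀| + 2)) / (2 * η) = c + 1 := by
    rw [hc_def]; ring
  rw [ea] at hnear ⊢
  -- `0 ≤ c`
  have hL : 1 < Real.log (|γ₀| + 2) := by
    rw [Real.lt_log_iff_exp_lt (by positivity)]
    linarith [Real.exp_one_lt_d9, abs_nonneg γ₀]
  have hlogL : 0 ≤ Real.log (Real.log (|γ₀| + 2)) := (Real.log_pos hL).le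
  have hc0 : 0 ≤ c := by
    have := clusterFarC0p_nonneg hψ0 hη hΦ N R₀ p δ
    have : 0 ≤ Real.log (Real.log (|γ₀| + 2)) / (2 * η) := by positivity
    linarith
  have hc1 : 0 ≤ c + 1 := by linarith
  -- the internal parameters `R = e^{(c+1)/2}`, `Δ₀ = e^{(c+1)/(2p+2)}`, `θ = Θ(γ₀, R)`
  set R : ℝ := Real.exp ((c + 1) / 2) with hR_def
  set Δ₀ : ℝ := Real.exp ((c + 1) / (2 * p + 2)) with hΔ_def
  have hR : 1 ≤ R := Real.one_le_exp (by positivity)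
  have hR1 : Real.exp (c + 1) ≤ R ^ 2 := by
    rw [hR_def, ← Real.exp_nat_mul]; push_cast
    exact Real.exp_le_exp.mpr (by linarith)
  have hΔ1 : 1 ≤ Δ₀ := Real.one_le_exp (by positivity)
  obtain ⟨hθ0, hθ2, hoff⟩ := windowMaxOffset_spec γ₀ R
  have hΔ : Real.exp (windowMaxOffset γ₀ R * (c + 1)) ≤ Δ₀ ^ (p + 1) := by
    rw [hΔ_def, ← Real.exp_nat_mul]
    refine Real.exp_le_exp.mpr ?_
    have hp : ((p + 1 : ℕ) : ℝ) * ((c + 1) / (2 * p + 2)) = (c + 1) / 2 := by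
      push_cast; field_simp
    rw [hp]
    nlinarith
  have hloc : ∀ ρ : ℂ, riemannZeta ρ = 0 → 0 ≤ ρ.re → ρ.re ≤ 1 → |ρ.im - γ₀| < R →
      ρ.re ≠ 1 / 2 → ρ = 1 / 2 + η + γ₀ * I ∨ ρ = 1 / 2 - η + γ₀ * I ∨ ρ ∈ S' ∨
        (|ρ.re - 1 / 2| ≤ windowMaxOffset γ₀ R ∧ Δ₀ ≤ |ρ.im - γ₀|) := by
    intro ρ hz h0 h1 hRρ hre
    by_cases hn : |ρ.im - γ₀| < Δ₀
    · rcases hnear ρ hz h0 h1 hn hre with h | h | h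
      · exact Or.inl h
      · exact Or.inr (Or.inl h)
      · exact Or.inr (Or.inr (Or.inl h))
    · exact Or.inr (Or.inr (Or.inr ⟨hoff ρ hz h0 h1 hRρ, not_lt.mp hn⟩))
  exact weilGroundEnergy_neg_of_farOffset_cluster_decay_window_eff hψ hsupp hψ0 hη hη2 hΦ N R₀ p
    hδ hδ1 hθ2 γ₀ c R Δ₀ S' hγ le_rfl hR hR1 hΔ hΔ1 hζ hcard hclus hloc

/-- **T35″ (the near-cluster wall, exclusion form).**  Weil positivity at the double-log window
`a(γ₀)` and the near-cluster hypothesis in the zone `|Im ρ − γ₀| < e^{a/(2p+2)}` exclude the zero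
`½ + η + iγ₀`; nothing is assumed about any other zero. -/
theorem riemannZeta_ne_zero_of_nearCluster_closed_eff (hψ : ContDiff ℝ ∞ ψ)
    (hsupp : tsupport ψ ⊆ Icc (-1) 1) (hψ0 : ∀ s, 0 ≤ ψ s) {η : ℝ} (hη : 0 < η)
    (hη2 : η < 1 / 2) (hΦ : 0 < bumpLaplace ψ η) (N : ℕ) (R₀ : ℝ) (p : ℕ) {δ : ℝ} (hδ : 0 < δ)
    (hδ1 : δ ≤ 1) :
    ∀ (γ₀ : ℝ) (S' : Finset ℂ), 1 ≤ |γ₀| → S'.card ≤ N →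
      (∀ ρ ∈ S', ‖ρ - (1 / 2 + γ₀ * I)‖ ≤ R₀ ∧ δ ≤ ‖ρ - (1 / 2 + η + γ₀ * I)‖ ∧
          δ ≤ ‖ρ - (1 / 2 - η + γ₀ * I)‖) →
      (∀ ρ : ℂ, riemannZeta ρ = 0 → 0 ≤ ρ.re → ρ.re ≤ 1 →
          |ρ.im - γ₀| < Real.exp ((clusterFarC0p ψ N R₀ p δ η + 1 +
            Real.log (Real.log (|γ₀| + 2)) / (2 * η)) / (2 * p + 2)) → ρ.re ≠ 1 / 2 →
          ρ = 1 / 2 + η + γ₀ * I ∨ ρ = 1 / 2 - η + γ₀ * I ∨ ρ ∈ S') →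
      0 ≤ weilGroundEnergy (clusterFarC0p ψ N R₀ p δ η + 1 +
        Real.log (Real.log (|γ₀| + 2)) / (2 * η)) →
      riemannZeta (1 / 2 + η + γ₀ * I) ≠ 0 := by
  intro γ₀ S' hγ hcard hclus hnear hE hζ
  have := weilGroundEnergy_neg_of_nearCluster_closed_eff hψ hsupp hψ0 hη hη2 hΦ N R₀ p hδ hδ1 γ₀ S'
    hγ hζ hcard hclus hnear
  linarith

/-- **T35‴ (parameter-free exclusion form, either sign of `η`).**  With `ψ₁ = windowPlateau 1`
and the window `a(γ₀) = clusterFarC0p ψ₁ N R₀ p δ |η| + 1 + log log(|γ₀| + 2)/(2|η|)`: for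
`η ≠ 0`, `|η| < ½`, `0 < δ ≤ 1`, `|γ₀| ≥ 1`, the near-cluster hypothesis in the zone
`|Im ρ − γ₀| < e^{a/(2p+2)}` and `weilGroundEnergy a ≥ 0` imply `ζ(½ + η + iγ₀) ≠ 0`. -/
theorem riemannZeta_ne_zero_of_nearCluster_closed_offset_eff {η : ℝ} (hη0 : η ≠ 0)
    (hη : |η| < 1 / 2) (N : ℕ) (R₀ : ℝ) (p : ℕ) {δ : ℝ} (hδ : 0 < δ) (hδ1 : δ ≤ 1) :
    ∀ (γ₀ : ℝ) (S' : Finset ℂ), 1 ≤ |γ₀| → S'.card ≤ N →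
      (∀ ρ ∈ S', ‖ρ - (1 / 2 + γ₀ * I)‖ ≤ R₀ ∧ δ ≤ ‖ρ - (1 / 2 + η + γ₀ * I)‖ ∧
          δ ≤ ‖ρ - (1 / 2 - η + γ₀ * I)‖) →
      (∀ ρ : ℂ, riemannZeta ρ = 0 → 0 ≤ ρ.re → ρ.re ≤ 1 →
          |ρ.im - γ₀| < Real.exp ((clusterFarC0p (windowPlateau 1) N R₀ p δ |η| + 1 +
            Real.log (Real.log (|γ₀| + 2)) / (2 * |η|)) / (2 * p + 2)) → ρ.re ≠ 1 / 2 →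
          ρ = 1 / 2 + η + γ₀ * I ∨ ρ = 1 / 2 - η + γ₀ * I ∨ ρ ∈ S') →
      0 ≤ weilGroundEnergy (clusterFarC0p (windowPlateau 1) N R₀ p δ |η| + 1 +
        Real.log (Real.log (|γ₀| + 2)) / (2 * |η|)) →
      riemannZeta (1 / 2 + η + γ₀ * I) ≠ 0 := by
  have hpos : 0 < |η| := abs_pos.mpr hη0
  have hT := riemannZeta_ne_zero_of_nearCluster_closed_eff (ψ := windowPlateau 1)
    (contDiff_windowPlateau 1) (tsupport_windowPlateau_subset 1) (windowPlateau_nonneg 1) hpos hη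
    (bumpLaplace_windowPlateau_one_pos |η|) N R₀ p hδ hδ1
  intro γ₀ S' hγ hcard hclus hnear hE
  rcases le_or_gt 0 η with h | h
  · have e : |η| = η := abs_of_nonneg h
    rw [e] at hT hnear hE
    exact hT γ₀ S' hγ hcard hclus hnear hE
  · have e : |η| = -η := abs_of_neg h
    rw [e] at hT hnear hE
    intro hζ
    refine hT γ₀ S' hγ hcard ?_ ?_ hE ?_
    · intro ρ hρ
      obtain ⟨h1, h2, h3⟩ := hclus ρ hρ
      push_cast
      refine ⟨h1, ?_, ?_⟩
      · rw [show (1 / 2 + -(η : ℂ) + γ₀ * I) = 1 / 2 - η + γ₀ * I by ring]; exact h3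
      · rw [show (1 / 2 - -(η : ℂ) + γ₀ * I) = 1 / 2 + η + γ₀ * I by ring]; exact h2
    · intro ρ hz h0 h1 hn hre
      push_cast
      rw [show (1 / 2 + -(η : ℂ) + γ₀ * I) = 1 / 2 - η + γ₀ * I by ring,
        show (1 / 2 - -(η : ℂ) + γ₀ * I) = 1 / 2 + η + γ₀ * I by ring]
      rcases hnear ρ hz h0 h1 hn hre with h' | h' | h'
      · exact Or.inr (Or.inl h')
      · exact Or.inl h'
      · exact Or.inr (Or.inr h')
    · push_cast
      rw [show (1 / 2 + -(η : ℂ) + γ₀ * I) = 1 / 2 - η + γ₀ * I by ring]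
      exact riemannZeta_zero_reflect hη hζ

end Summit.RiemannHypothesis.RiemannHypothesis.Theorems
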